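import Summits.Ventures.Crystal3D.Theorems.StickyWulffConstantNoReconstructionGainWindowLoad
import Literature.Geometry.DiscreteGeometry.KerteszNinePointsHemisphereHolds
import HarnessLib

/-!
# The hexagon gap: six equatorial partners push every other partner to height `≥ √(2/3)`
# (crux `NoReconstructionGain`, stmt-Ventures-19144, line `replication-exactness`, inside `stub_noCriminal`)

HONEST FRAMING. Part of the venture `Summits/Ventures/Crystal3D` (cell `crystal3d-full`), helper `--supports` the
crux `NoReconstructionGain` (stmt-Ventures-19144, route `route-Ventures-StickyWulffConstant`), lead wulff-p1 g24.
Two COROLLARIES of the sliding-window weighted kissing bound (`weightedWindowKissing_le_six`, this lead); spherical-code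
facts, not film theorems; the crux is not moved.

* `abs_height_ge_of_six_equatorial` — **the hexagon gap.**  If a `60°`-code of unit vectors of `ℝ³` contains six
  vectors on the equator `u₂ = 0`, then every OTHER vector of the code has `|u₂| ≥ √(2/3)`.  (The six weigh `1`
  each in the window `[−d, √(2/3) − d]` through the other vector, exhausting the budget `6`, so the other vector's
  weight `1 − |u₂|/√(2/3)` must vanish.)  This is the geometric origin of the close-packed layer spacing
  `c = √(2/3)`: a ball with a complete level hexagon of contacts has all further contacts at height `≥ c` above or
  below it — with no appeal to the regularity of the hexagon.
* `card_eq_of_six_equatorial` — hence such a code has EXACTLY six equatorial members and `#F = 6 + #{|u₂| ≥ √(2/3)}`.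
* `nine_lower_structure` — **Kertész, sharpened by the gap**: nine `60°`-code vectors in the closed lower hemisphere
  `u₂ ≤ 0` consist of exactly six ON the equator and three at depth `≥ √(2/3)` (Kertész 1994 gives the six; the
  hexagon gap pushes the rest a full layer spacing down).  In film language: a ball with nine partners in its closed
  lower half-space has a complete level hexagon and three partners at least one close-packed layer below.
* `card_le_eight_of_lower_band` — so a `60°`-code in a lower band `[−d, 0]` of depth `d < √(2/3)` has at most EIGHT
  members: the top ball of a `(111)` film whose partners reach less than a layer spacing below it has `≤ 8` partners.

WHAT THIS IS NOT: the first two items do not use Kertész's theorem (which PRODUCES six equatorial vectors from nine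
one-sided ones; the last two items combine it with the gap); no film theorem; rung F-C1 not moved.
-/

noncomputable section

namespace Summit.Ventures.Crystal3D.Theorems

open Finset Real
open scoped InnerProductSpace

/-- **The hexagon gap.**  In a finite `60°`-code of unit vectors of `ℝ³` with (at least) six members on the
equator `u₂ = 0`, every other member has `|u₂| ≥ √(2/3)`. -/
theorem abs_height_ge_of_six_equatorial (F : Finset (EuclideanSpace ℝ (Fin 3))) (h1 : ∀ u ∈ F, ‖u‖ = 1)
    (h2 : ∀ u ∈ F, ∀ v ∈ F, u ≠ v → ⟪u, v⟫_ℝ ≤ 1 / 2)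
    (h6 : 6 ≤ (F.filter fun u => u 2 = 0).card) {v : EuclideanSpace ℝ (Fin 3)} (hv : v ∈ F)
    (hv0 : v 2 ≠ 0) : Real.sqrt (2 / 3) ≤ |v 2| := by
  classical
  set c : ℝ := Real.sqrt (2 / 3) with hc
  have hcpos : 0 < c := Real.sqrt_pos.2 (by norm_num)
  by_contra hlt
  push Not at hlt
  have hlt' := abs_lt.1 hlt
  -- the window `[−d, c − d]` with `d := max 0 (−v₂)` contains the equator and `v`
  set d : ℝ := max 0 (-v 2) with hd
  have hd0 : 0 ≤ d := le_max_left _ _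
  have hdc : d ≤ c := by
    rw [hd, max_le_iff]
    exact ⟨hcpos.le, by linarith [hlt'.1]⟩
  have hvwin : -d ≤ v 2 ∧ v 2 ≤ c - d := by
    rcases le_or_gt 0 (v 2) with h | h
    · have : d = 0 := by rw [hd, max_eq_left]; linarith
      rw [this]; constructor <;> linarith [hlt'.2]
    · have : d = -v 2 := by rw [hd, max_eq_right]; linarith
      rw [this]; constructor <;> linarith
  have hW := weightedWindowKissing_le_six F h1 h2 hd0 hdc
  set W := F.filter (fun u => -d ≤ u 2 ∧ u 2 ≤ c - d) with hWdef
  -- the six equatorial vectors and `v` all lie in the window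
  set E := F.filter (fun u => u 2 = 0) with hE
  have hEW : E ⊆ W := by
    intro u hu
    rw [hE, mem_filter] at hu
    rw [hWdef, mem_filter]
    exact ⟨hu.1, by rw [hu.2]; linarith, by rw [hu.2]; linarith⟩
  have hvW : v ∈ W := by rw [hWdef, mem_filter]; exact ⟨hv, hvwin⟩
  have hvE : v ∉ E := by rw [hE, mem_filter]; exact fun h => hv0 h.2
  -- weights: `1` on `E`, `1 − |v₂|/c > 0` at `v`, `≥ 0` elsewhere
  have hnonneg : ∀ u ∈ W, 0 ≤ 1 - |u 2| / c := by
    intro u hu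
    rw [hWdef, mem_filter] at hu
    rw [sub_nonneg, div_le_one hcpos, abs_le]
    constructor <;> linarith [hu.2.1, hu.2.2]
  have hsplit : ∑ u ∈ W, (1 - |u 2| / c) ≥ ∑ u ∈ insert v E, (1 - |u 2| / c) :=
    sum_le_sum_of_subset_of_nonneg (insert_subset hvW hEW) fun u hu _ => hnonneg u hu
  rw [sum_insert hvE] at hsplit
  have hEsum : ∑ u ∈ E, (1 - |u 2| / c) = E.card := by
    rw [sum_congr rfl fun u hu => by rw [(mem_filter.1 hu).2, abs_zero, zero_div, sub_zero], sum_const,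
      nsmul_eq_mul, mul_one]
  rw [hEsum] at hsplit
  have h6' : (6 : ℝ) ≤ E.card := by exact_mod_cast h6
  have hvpos : 0 < 1 - |v 2| / c := by
    rw [sub_pos, div_lt_one hcpos]; exact hlt
  simp only [← hc] at hW
  linarith

/-- **Exactly six, plus the far ones.**  A finite `60°`-code of unit vectors of `ℝ³` with at least six members on
the equator has EXACTLY six there (`weightedWindowKissing_le_six` with `d = 0`: each weighs `1`) and no member with
`0 < |u₂| < √(2/3)` (`abs_height_ge_of_six_equatorial`), so `#F = 6 + #{u ∈ F : |u₂| ≥ √(2/3)}`. -/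
theorem card_eq_of_six_equatorial (F : Finset (EuclideanSpace ℝ (Fin 3))) (h1 : ∀ u ∈ F, ‖u‖ = 1)
    (h2 : ∀ u ∈ F, ∀ v ∈ F, u ≠ v → ⟪u, v⟫_ℝ ≤ 1 / 2)
    (h6 : 6 ≤ (F.filter fun u => u 2 = 0).card) :
    (F.filter fun u => u 2 = 0).card = 6 ∧
      F.card = 6 + (F.filter fun u => Real.sqrt (2 / 3) ≤ |u 2|).card := by
  classical
  set c : ℝ := Real.sqrt (2 / 3) with hc
  have hcpos : 0 < c := Real.sqrt_pos.2 (by norm_num)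
  -- the equatorial vectors are at most six: window `d = 0`, each weighs `1`
  have hW := weightedWindowKissing_le_six F h1 h2 le_rfl hcpos.le
  set E := F.filter (fun u => u 2 = 0) with hE
  set W := F.filter (fun u => -(0 : ℝ) ≤ u 2 ∧ u 2 ≤ c - 0) with hWdef
  have hEW : E ⊆ W := by
    intro u hu
    rw [hE, mem_filter] at hu
    rw [hWdef, mem_filter]
    exact ⟨hu.1, by rw [hu.2]; simp, by rw [hu.2]; simpa using hcpos.le⟩
  have hnonneg : ∀ u ∈ W, 0 ≤ 1 - |u 2| / c := by
    intro u hu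
    rw [hWdef, mem_filter] at hu
    rw [sub_nonneg, div_le_one hcpos, abs_le]
    constructor <;> linarith [hu.2.1, hu.2.2]
  have hle := sum_le_sum_of_subset_of_nonneg hEW fun u hu _ => hnonneg u hu
  have hEsum : ∑ u ∈ E, (1 - |u 2| / c) = E.card := by
    rw [sum_congr rfl fun u hu => by rw [(mem_filter.1 hu).2, abs_zero, zero_div, sub_zero], sum_const,
      nsmul_eq_mul, mul_one]
  rw [hEsum] at hle
  simp only [← hc] at hW
  have hE6 : (E.card : ℝ) ≤ 6 := hle.trans hW
  have hE6' : E.card ≤ 6 := by exact_mod_cast hE6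
  have hEeq : E.card = 6 := le_antisymm hE6' h6
  refine ⟨hEeq, ?_⟩
  -- partition `F` into the equatorial members and the far ones
  have hpart : F = E ∪ F.filter (fun u => c ≤ |u 2|) := by
    ext u
    rw [mem_union, hE, mem_filter, mem_filter]
    constructor
    · intro hu
      by_cases h0 : u 2 = 0
      · exact Or.inl ⟨hu, h0⟩
      · exact Or.inr ⟨hu, abs_height_ge_of_six_equatorial F h1 h2 h6 hu h0⟩
    · rintro (h | h)
      · exact h.1
      · exact h.1
  have hdisj : Disjoint E (F.filter fun u => c ≤ |u 2|) := by
    rw [Finset.disjoint_left]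
    intro u huE huF
    rw [hE, mem_filter] at huE
    rw [mem_filter] at huF
    have := huF.2
    rw [huE.2, abs_zero] at this
    linarith
  rw [hpart, card_union_of_disjoint hdisj, hEeq]
  congr 1
  rw [← hpart]

/-! ## Nine one-sided vectors: Kertész sharpened by the gap -/

/-- The third coordinate is the `e₃`-height (local copy). -/
private theorem inner_e3_gap (v : EuclideanSpace ℝ (Fin 3)) :
    ⟪EuclideanSpace.single 2 (1 : ℝ), v⟫_ℝ = v 2 := by
  rw [real_inner_comm, EuclideanSpace.inner_single_right]; simp

/-- Unit vectors with inner product `≤ 1/2` are at distance `≥ 1` (local copy). -/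
private theorem one_le_dist_of_inner_le_half' {u v : EuclideanSpace ℝ (Fin 3)} (hu : ‖u‖ = 1)
    (hv : ‖v‖ = 1) (h : ⟪u, v⟫_ℝ ≤ 1 / 2) : 1 ≤ dist u v := by
  have h2 : dist u v ^ 2 = 2 - 2 * ⟪u, v⟫_ℝ := by
    rw [dist_eq_norm, norm_sub_sq_real, hu, hv]; ring
  nlinarith [h2, dist_nonneg (x := u) (y := v)]

/-- **Nine one-sided code vectors: six on the equator, three a layer spacing below.**  A `60°`-code of nine unit
vectors of `ℝ³` in the closed lower hemisphere `u₂ ≤ 0` has exactly six members with `u₂ = 0` and every other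
member has `u₂ ≤ −√(2/3)` (Kertész 1994 + the hexagon gap). -/
theorem nine_lower_structure (T : Finset (EuclideanSpace ℝ (Fin 3))) (h1 : ∀ u ∈ T, ‖u‖ = 1)
    (h2 : ∀ u ∈ T, ∀ v ∈ T, u ≠ v → ⟪u, v⟫_ℝ ≤ 1 / 2) (hlow : ∀ u ∈ T, u 2 ≤ 0) (h9 : T.card = 9) :
    (T.filter fun u => u 2 = 0).card = 6 ∧ ∀ u ∈ T, u 2 ≠ 0 → u 2 ≤ -Real.sqrt (2 / 3) := by
  classical
  set e : EuclideanSpace ℝ (Fin 3) := -EuclideanSpace.single 2 (1 : ℝ) with he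
  have hen : ‖e‖ = 1 := by rw [he, norm_neg, PiLp.norm_single, norm_one]
  have hein : ∀ v : EuclideanSpace ℝ (Fin 3), ⟪e, v⟫_ℝ = -v 2 := by
    intro v; rw [he, inner_neg_left, inner_e3_gap]
  have hhemi : ∀ v ∈ T, 0 ≤ ⟪e, v⟫_ℝ := fun v hv => by rw [hein]; linarith [hlow v hv]
  have hsep : ∀ v ∈ T, ∀ w ∈ T, v ≠ w → 1 ≤ dist v w :=
    fun v hv w hw hvw => one_le_dist_of_inner_le_half' (h1 v hv) (h1 w hw) (h2 v hv w hw hvw)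
  have hK := Literature.Geometry.DiscreteGeometry.kertesz1994_ninePointsHemisphere_holds e hen T h1 hhemi hsep h9
  have hfilt : (T.filter fun v => ⟪e, v⟫_ℝ = 0) = T.filter fun u => u 2 = 0 := by
    refine Finset.filter_congr fun u _ => ?_
    rw [hein, neg_eq_zero]
  rw [hfilt] at hK
  obtain ⟨h6, -⟩ := card_eq_of_six_equatorial T h1 h2 hK
  refine ⟨h6, fun u hu hu0 => ?_⟩
  have hgap := abs_height_ge_of_six_equatorial T h1 h2 hK hu hu0
  have hneg : u 2 < 0 := lt_of_le_of_ne (hlow u hu) hu0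
  rw [abs_of_neg hneg] at hgap
  linarith

/-- **At most eight in a shallow lower band.**  A `60°`-code of unit vectors of `ℝ³` contained in a lower band
`−d ≤ u₂ ≤ 0` of depth `d < √(2/3)` has at most eight members (nine would need three members at depth
`≥ √(2/3)`, `nine_lower_structure`; ten or more are excluded by `B(3) = 9`). -/
theorem card_le_eight_of_lower_band (T : Finset (EuclideanSpace ℝ (Fin 3))) (h1 : ∀ u ∈ T, ‖u‖ = 1)
    (h2 : ∀ u ∈ T, ∀ v ∈ T, u ≠ v → ⟪u, v⟫_ℝ ≤ 1 / 2) {d : ℝ} (hd : d < Real.sqrt (2 / 3))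
    (hband : ∀ u ∈ T, -d ≤ u 2 ∧ u 2 ≤ 0) : T.card ≤ 8 := by
  classical
  set e : EuclideanSpace ℝ (Fin 3) := -EuclideanSpace.single 2 (1 : ℝ) with he
  have hen : ‖e‖ = 1 := by rw [he, norm_neg, PiLp.norm_single, norm_one]
  have hein : ∀ v : EuclideanSpace ℝ (Fin 3), ⟪e, v⟫_ℝ = -v 2 := by
    intro v; rw [he, inner_neg_left, inner_e3_gap]
  have hhemi : ∀ v ∈ T, 0 ≤ ⟪e, v⟫_ℝ := fun v hv => by rw [hein]; linarith [(hband v hv).2]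
  have hsep : ∀ v ∈ T, ∀ w ∈ T, v ≠ w → 1 ≤ dist v w :=
    fun v hv w hw hvw => one_le_dist_of_inner_le_half' (h1 v hv) (h1 w hw) (h2 v hv w hw hvw)
  have h9 : T.card ≤ 9 := Literature.Geometry.DiscreteGeometry.card_le_nine_of_unit_normal hen h1 hhemi hsep
  by_contra h8
  have hT9 : T.card = 9 := by omega
  obtain ⟨h6, hdeep⟩ := nine_lower_structure T h1 h2 (fun u hu => (hband u hu).2) hT9
  -- some member is off the equator (only six are on it), and it is too deep
  have hne : ((T.filter fun u => ¬ u 2 = 0)).Nonempty := by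
    rw [← Finset.card_pos]
    have := Finset.card_filter_add_card_filter_not (s := T) (fun u => u 2 = 0)
    omega
  obtain ⟨u, hu⟩ := hne
  rw [mem_filter] at hu
  have := hdeep u hu.1 hu.2
  linarith [(hband u hu.1).1]

end Summit.Ventures.Crystal3D.Theorems

end
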